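import Mathlib
import HarnessLib
import Summits.AtomisticToContinuum.FouriersLaw.Theses.JunctionLocality
import Summits.AtomisticToContinuum.FouriersLaw.Theorems.JunctionLocalitySuperadditiveResistanceDeviceLiouville

/-!
# Termination locality in Kubo form, helper II: the block swap `(N, M) ↔ (M, N)` of the device
(stub `stub_terminationLocality` of line `floating-probe-bypass-laplacian`, crux
`JunctionLocality.SuperadditiveResistance`, stmt-AtomisticToContinuum-11748)

The stub has a LEFT-block clause (`1/G_N − 1/K_00 ≤ C₁`) and a RIGHT-block clause
(`1/G_M − 1/K_33 ≤ C₁`, the bare `M`-chain entering through its LEFT forward field). This file proves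
the kinematics making the right-block clause the left-block clause of the SWAPPED split `(M, N)`:
the site reversal `j ↦ N+M−1−j` of positions and momenta, `Φ_{N,M} : PhaseSpace (N+M) ≃L[ℝ]
PhaseSpace (M+N)` (`blockSwap`), is a symmetry of every oscillator chain with even interaction and
maps the `(N, M)`-device (thermostats on sites `0, N−1, N, N+M−1`, temperatures `τ 0, …, τ 3`) onto
the `(M, N)`-device with the temperature profile reversed (`deviceGenerator_comp_blockSwap`); it
exchanges the terminal kinetic observables accordingly (`kin_blockSwap`) and preserves the
Hamiltonian, Lebesgue measure and hence the Gibbs state (`integral_gibbsMeasure_comp_blockSwap`,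
`measurePreserving_blockSwap_gibbsMeasure`, `memLp_comp_blockSwap`). The relabelling calculus
(`relabel`, `partialP_comp_relabel`, …) is written for an arbitrary bijection of site labels.
Folklore; no named fact is used.
-/

noncomputable section

open MeasureTheory Filter Topology
open scoped ContDiff
open Literature.MathematicalPhysics.KineticTheory.HeatConduction
open Summit.AtomisticToContinuum.FouriersLaw.Theorems.SuperadditiveResistance.DeviceLiouville

namespace Summit.AtomisticToContinuum.FouriersLaw.Theorems.SuperadditiveResistance.TerminationLocality

/-! ## Relabelling the sites along a bijection -/

section Relabel

variable {L L' : ℕ}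

/-- Coordinate relabelling `(q, p) ↦ (q ∘ e, p ∘ e)` along `e : Fin L' ≃ Fin L` (linear iso). -/
def relabel (e : Fin L' ≃ Fin L) : PhaseSpace L ≃L[ℝ] PhaseSpace L' :=
  ((LinearEquiv.funCongrLeft ℝ ℝ e).prodCongr
    (LinearEquiv.funCongrLeft ℝ ℝ e)).toContinuousLinearEquiv

/-- Relabelled positions. -/
@[simp] theorem relabel_fst (e : Fin L' ≃ Fin L) (x : PhaseSpace L) (i : Fin L') :
    (relabel e x).1 i = x.1 (e i) := rfl

/-- Relabelled momenta. -/
@[simp] theorem relabel_snd (e : Fin L' ≃ Fin L) (x : PhaseSpace L) (i : Fin L') :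
    (relabel e x).2 i = x.2 (e i) := rfl

/-- Unfolding `relabel`. -/
theorem relabel_apply (e : Fin L' ≃ Fin L) (x : PhaseSpace L) :
    relabel e x = (x.1 ∘ e, x.2 ∘ e) := rfl

/-- `∂_{p_j}(f ∘ Φ_e) = (∂_{p_{e⁻¹ j}} f) ∘ Φ_e` (no differentiability needed: both sides are
derivatives of the same one-variable slice). -/
theorem partialP_comp_relabel (e : Fin L' ≃ Fin L) (f : PhaseSpace L' → ℝ) (j : Fin L)
    (x : PhaseSpace L) :
    partialP j (f ∘ relabel e) x = partialP (e.symm j) f (relabel e x) := by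
  unfold partialP
  simp only [Function.comp_apply, relabel_apply, Function.update_comp_equiv,
    Equiv.apply_symm_apply]

/-- `∂_{q_j}(f ∘ Φ_e) = (∂_{q_{e⁻¹ j}} f) ∘ Φ_e`. -/
theorem partialQ_comp_relabel (e : Fin L' ≃ Fin L) (f : PhaseSpace L' → ℝ) (j : Fin L)
    (x : PhaseSpace L) :
    partialQ j (f ∘ relabel e) x = partialQ (e.symm j) f (relabel e x) := by
  unfold partialQ
  simp only [Function.comp_apply, relabel_apply, Function.update_comp_equiv,
    Equiv.apply_symm_apply]

/-- `∂²_{p_j}(f ∘ Φ_e) = (∂²_{p_{e⁻¹ j}} f) ∘ Φ_e`. -/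
theorem partialP_partialP_comp_relabel (e : Fin L' ≃ Fin L) (f : PhaseSpace L' → ℝ) (j : Fin L)
    (x : PhaseSpace L) :
    partialP j (partialP j (f ∘ relabel e)) x =
      partialP (e.symm j) (partialP (e.symm j) f) (relabel e x) := by
  have h : partialP j (f ∘ relabel e) = partialP (e.symm j) f ∘ relabel e :=
    funext (partialP_comp_relabel e f j)
  rw [h, partialP_comp_relabel]

/-- Relabelling as a measurable equivalence (product of two coordinate permutations). -/
def relabelM (e : Fin L' ≃ Fin L) : PhaseSpace L ≃ᵐ PhaseSpace L' :=
  MeasurableEquiv.prodCongr (MeasurableEquiv.piCongrLeft (fun _ : Fin L' => ℝ) e.symm)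
    (MeasurableEquiv.piCongrLeft (fun _ : Fin L' => ℝ) e.symm)

/-- The measurable equivalence is the relabelling map. -/
@[simp] theorem relabelM_apply (e : Fin L' ≃ Fin L) (x : PhaseSpace L) :
    relabelM e x = relabel e x := by
  refine Prod.ext (funext fun i => ?_) (funext fun i => ?_)
  · show (MeasurableEquiv.piCongrLeft (fun _ : Fin L' => ℝ) e.symm) x.1 i = x.1 (e i)
    rw [MeasurableEquiv.coe_piCongrLeft, Equiv.piCongrLeft_apply_eq_cast]
    simp
  · show (MeasurableEquiv.piCongrLeft (fun _ : Fin L' => ℝ) e.symm) x.2 i = x.2 (e i)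
    rw [MeasurableEquiv.coe_piCongrLeft, Equiv.piCongrLeft_apply_eq_cast]
    simp

/-- Relabelling preserves Lebesgue measure on phase space. -/
theorem measurePreserving_relabelM (e : Fin L' ≃ Fin L) :
    MeasurePreserving (relabelM e) (volume : Measure (PhaseSpace L)) volume :=
  (volume_measurePreserving_piCongrLeft (fun _ : Fin L' => ℝ) e.symm).prod
    (volume_measurePreserving_piCongrLeft (fun _ : Fin L' => ℝ) e.symm)

/-- `∫ F (Φ_e x) dx = ∫ F`. -/
theorem integral_comp_relabel (e : Fin L' ≃ Fin L) (F : PhaseSpace L' → ℝ) :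
    ∫ x, F (relabel e x) = ∫ y, F y := by
  have h := (measurePreserving_relabelM e).integral_comp' (f := relabelM e) F
  simpa only [relabelM_apply] using h

end Relabel

/-! ## The block swap `Φ_{N,M}` -/

section Swap

variable (N M : ℕ)

/-- Site reversal between the two orderings of the split: `Fin (M + N) ≃ Fin (N + M)`,
`i ↦ N + M − 1 − i`. -/
def swapIdx (N M : ℕ) : Fin (M + N) ≃ Fin (N + M) where
  toFun i := ⟨N + M - 1 - i.val, by have := i.isLt; omega⟩
  invFun j := ⟨M + N - 1 - j.val, by have := j.isLt; omega⟩
  left_inv i := Fin.ext (by have := i.isLt; simp only; omega)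
  right_inv j := Fin.ext (by have := j.isLt; simp only; omega)

/-- Value of the site reversal. -/
@[simp] theorem swapIdx_val (i : Fin (M + N)) : (swapIdx N M i).val = N + M - 1 - i.val := rfl

/-- The inverse of the site reversal of the split `(N, M)` is the site reversal of `(M, N)`. -/
theorem swapIdx_symm : (swapIdx N M).symm = swapIdx M N := by
  ext j
  rfl

/-- **The block swap** `Φ_{N,M} : (q, p) ↦ (q ∘ σ, p ∘ σ)`, `σ i = N+M−1−i`: site `i` of the image
is site `N+M−1−i` of the source, so the right block of the split `(N, M)` becomes the LEFT block
of the split `(M, N)`. -/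
def blockSwap (N M : ℕ) : PhaseSpace (N + M) ≃L[ℝ] PhaseSpace (M + N) := relabel (swapIdx N M)

/-- Swapped positions. -/
@[simp] theorem blockSwap_fst (x : PhaseSpace (N + M)) (i : Fin (M + N)) :
    (blockSwap N M x).1 i = x.1 (swapIdx N M i) := rfl

/-- Swapped momenta. -/
@[simp] theorem blockSwap_snd (x : PhaseSpace (N + M)) (i : Fin (M + N)) :
    (blockSwap N M x).2 i = x.2 (swapIdx N M i) := rfl

/-- The block swaps of `(N, M)` and `(M, N)` are mutually inverse. -/
@[simp] theorem blockSwap_blockSwap (x : PhaseSpace (N + M)) :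
    blockSwap M N (blockSwap N M x) = x := by
  have h : ∀ j : Fin (N + M), swapIdx N M (swapIdx M N j) = j := fun j => by
    rw [← swapIdx_symm N M]; exact (swapIdx N M).apply_symm_apply j
  refine Prod.ext (funext fun j => ?_) (funext fun j => ?_)
  · show x.1 (swapIdx N M (swapIdx M N j)) = x.1 j
    rw [h]
  · show x.2 (swapIdx N M (swapIdx M N j)) = x.2 j
    rw [h]

/-- `∂_{p_j}(f ∘ Φ) = (∂_{p_{σ⁻¹ j}} f) ∘ Φ`. -/
theorem partialP_comp_blockSwap (f : PhaseSpace (M + N) → ℝ) (j : Fin (N + M))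
    (x : PhaseSpace (N + M)) :
    partialP j (f ∘ blockSwap N M) x = partialP (swapIdx M N j) f (blockSwap N M x) := by
  rw [blockSwap, partialP_comp_relabel, swapIdx_symm]

/-- `∂_{q_j}(f ∘ Φ) = (∂_{q_{σ⁻¹ j}} f) ∘ Φ`. -/
theorem partialQ_comp_blockSwap (f : PhaseSpace (M + N) → ℝ) (j : Fin (N + M))
    (x : PhaseSpace (N + M)) :
    partialQ j (f ∘ blockSwap N M) x = partialQ (swapIdx M N j) f (blockSwap N M x) := by
  rw [blockSwap, partialQ_comp_relabel, swapIdx_symm]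

/-- `∂²_{p_j}(f ∘ Φ) = (∂²_{p_{σ⁻¹ j}} f) ∘ Φ`. -/
theorem partialP_partialP_comp_blockSwap (f : PhaseSpace (M + N) → ℝ) (j : Fin (N + M))
    (x : PhaseSpace (N + M)) :
    partialP j (partialP j (f ∘ blockSwap N M)) x =
      partialP (swapIdx M N j) (partialP (swapIdx M N j) f) (blockSwap N M x) := by
  rw [blockSwap, partialP_partialP_comp_relabel, swapIdx_symm]

/-- Reindexing a sum over the sites of the split `(N, M)` by the sites of `(M, N)`. -/
theorem sum_swapIdx (F : Fin (N + M) → ℝ) : ∑ i : Fin (M + N), F (swapIdx N M i) = ∑ j, F j :=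
  Equiv.sum_comp (swapIdx N M) F

variable {N M}

/-- **The Hamiltonian is invariant under the block swap** (even interaction). -/
theorem hamiltonian_blockSwap (P : OscillatorChain) (hV : ∀ r, P.V (-r) = P.V r)
    (x : PhaseSpace (N + M)) :
    P.hamiltonian (M + N) (blockSwap N M x) = P.hamiltonian (N + M) x := by
  unfold OscillatorChain.hamiltonian
  simp only [blockSwap_fst, blockSwap_snd]
  congr 1
  · exact sum_swapIdx N M (fun j => x.2 j ^ 2 / 2 + P.U (x.1 j))
  · calc (∑ i : Fin (M + N), ∑ j : Fin (M + N),
          if j.val = i.val + 1 then P.V (x.1 (swapIdx N M j) - x.1 (swapIdx N M i)) else 0)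
        = ∑ i : Fin (N + M), ∑ j : Fin (N + M),
          if (swapIdx M N j).val = (swapIdx M N i).val + 1 then P.V (x.1 j - x.1 i) else 0 := by
          rw [← sum_swapIdx N M]
          refine Finset.sum_congr rfl fun i _ => ?_
          rw [← sum_swapIdx N M]
          refine Finset.sum_congr rfl fun j _ => ?_
          have hi : swapIdx M N (swapIdx N M i) = i := by
            rw [← swapIdx_symm N M]; exact (swapIdx N M).symm_apply_apply i
          have hj : swapIdx M N (swapIdx N M j) = j := by
            rw [← swapIdx_symm N M]; exact (swapIdx N M).symm_apply_apply j
          rw [hi, hj]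
      _ = ∑ i : Fin (N + M), ∑ j : Fin (N + M), if i.val = j.val + 1 then P.V (x.1 j - x.1 i) else 0 := by
          refine Finset.sum_congr rfl fun i _ => Finset.sum_congr rfl fun j _ => ?_
          have hij : ((swapIdx M N j).val = (swapIdx M N i).val + 1) ↔ (i.val = j.val + 1) := by
            have := i.isLt; have := j.isLt
            simp only [swapIdx_val]; omega
          rw [if_congr hij rfl rfl]
      _ = ∑ j : Fin (N + M), ∑ i : Fin (N + M), if i.val = j.val + 1 then P.V (x.1 j - x.1 i) else 0 :=
          Finset.sum_comm
      _ = _ := by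
          refine Finset.sum_congr rfl fun i _ => Finset.sum_congr rfl fun j _ => ?_
          split_ifs
          · rw [← hV, neg_sub]
          · rfl

/-- The force field transforms accordingly: `∂_{q_j} H_{N+M} = (∂_{q_{σ⁻¹ j}} H_{M+N}) ∘ Φ`. -/
theorem partialQ_hamiltonian_blockSwap (P : OscillatorChain) (hV : ∀ r, P.V (-r) = P.V r)
    (j : Fin (N + M)) (x : PhaseSpace (N + M)) :
    partialQ j (P.hamiltonian (N + M)) x =
      partialQ (swapIdx M N j) (P.hamiltonian (M + N)) (blockSwap N M x) := by
  have hH : P.hamiltonian (N + M) = P.hamiltonian (M + N) ∘ blockSwap N M :=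
    funext fun y => (hamiltonian_blockSwap P hV y).symm
  rw [hH, partialQ_comp_blockSwap]

/-- **Block-swap covariance of the plain generator**: `L^{(N+M)}_{a,b}(f ∘ Φ) = (L^{(M+N)}_{b,a} f) ∘ Φ`
(the end baths are exchanged). -/
theorem generator_comp_blockSwap (P : OscillatorChain) (hV : ∀ r, P.V (-r) = P.V r) (a b : ℝ)
    (f : PhaseSpace (M + N) → ℝ) (x : PhaseSpace (N + M)) :
    P.generator (N + M) a b (f ∘ blockSwap N M) x = P.generator (M + N) b a f (blockSwap N M x) := by
  have hQH : ∀ i, partialQ i (P.hamiltonian (N + M)) x =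
      partialQ (swapIdx M N i) (P.hamiltonian (M + N)) (blockSwap N M x) :=
    fun i => partialQ_hamiltonian_blockSwap P hV i x
  unfold OscillatorChain.generator
  simp only [partialQ_comp_blockSwap, partialP_comp_blockSwap, partialP_partialP_comp_blockSwap,
    hQH]
  congr 1
  · rw [← sum_swapIdx N M]
    refine Finset.sum_congr rfl fun i _ => ?_
    have hi : swapIdx M N (swapIdx N M i) = i := by
      rw [← swapIdx_symm N M]; exact (swapIdx N M).symm_apply_apply i
    simp only [hi, blockSwap_snd]
  · congr 1
    rw [← sum_swapIdx N M]
    refine Finset.sum_congr rfl fun i _ => ?_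
    have hi : swapIdx M N (swapIdx N M i) = i := by
      rw [← swapIdx_symm N M]; exact (swapIdx N M).symm_apply_apply i
    have h0 : ((swapIdx N M i).val = 0) ↔ (i.val = M + N - 1) := by
      have := i.isLt; simp only [swapIdx_val]; omega
    have h1 : ((swapIdx N M i).val = N + M - 1) ↔ (i.val = 0) := by
      have := i.isLt; simp only [swapIdx_val]; omega
    simp only [hi, blockSwap_snd]
    rw [if_congr h0 rfl rfl, if_congr h1 rfl rfl, add_comm]

/-- Block-swap covariance of a one-site thermostat: the thermostat on site `s` of the split
`(N, M)` is the thermostat on site `s' = N+M−1−s` of the split `(M, N)`. -/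
theorem thermo_comp_blockSwap {s s' : ℕ} (hs : s + s' = N + M - 1) (hsL : s < N + M) (θ : ℝ)
    (f : PhaseSpace (M + N) → ℝ) (x : PhaseSpace (N + M)) :
    thermo (N + M) s θ (f ∘ blockSwap N M) x = thermo (M + N) s' θ f (blockSwap N M x) := by
  unfold thermo
  simp only [partialP_comp_blockSwap, partialP_partialP_comp_blockSwap]
  rw [← sum_swapIdx N M]
  refine Finset.sum_congr rfl fun i _ => ?_
  have hi : swapIdx M N (swapIdx N M i) = i := by
    rw [← swapIdx_symm N M]; exact (swapIdx N M).symm_apply_apply i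
  have h0 : ((swapIdx N M i).val = s) ↔ (i.val = s') := by
    have := i.isLt; simp only [swapIdx_val]; omega
  simp only [hi, blockSwap_snd]
  rw [if_congr h0 rfl rfl]

/-- The kinetic observable of site `s` of the split `(N, M)` is that of site `s' = N+M−1−s` of
the split `(M, N)`: `p_{s'}²(Φ x) = p_s²(x)`. -/
theorem kin_blockSwap {s s' : ℕ} (hs : s + s' = N + M - 1) (hsL : s < N + M)
    (x : PhaseSpace (N + M)) : kin (M + N) s' (blockSwap N M x) = kin (N + M) s x := by
  unfold kin
  simp only [blockSwap_snd]
  rw [← sum_swapIdx N M]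
  refine Finset.sum_congr rfl fun i _ => ?_
  have h0 : ((swapIdx N M i).val = s) ↔ (i.val = s') := by
    have := i.isLt; simp only [swapIdx_val]; omega
  rw [if_congr h0 rfl rfl]

/-- **Block-swap covariance of the device generator.** The `(N, M)`-device (thermostats on sites
`0, N−1, N, N+M−1` at temperatures `τ 0, τ 1, τ 2, τ 3`) acting on `f ∘ Φ` is the `(M, N)`-device
with the REVERSED temperature profile `(τ 3, τ 2, τ 1, τ 0)` acting on `f`, evaluated at `Φ x`
(`N, M ≥ 1`). -/
theorem deviceGenerator_comp_blockSwap (P : OscillatorChain) (hV : ∀ r, P.V (-r) = P.V r)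
    (hN : 1 ≤ N) (hM : 1 ≤ M) (τ : Fin 4 → ℝ) (f : PhaseSpace (M + N) → ℝ)
    (x : PhaseSpace (N + M)) :
    deviceGenerator P N M τ (f ∘ blockSwap N M) x =
      deviceGenerator P M N ![τ 3, τ 2, τ 1, τ 0] f (blockSwap N M x) := by
  rw [deviceGenerator, deviceGenerator, generator_comp_blockSwap P hV,
    thermo_comp_blockSwap (s := N - 1) (s' := M) (by omega) (by omega),
    thermo_comp_blockSwap (s := N) (s' := M - 1) (by omega) (by omega)]
  simp only [Matrix.cons_val_zero, Matrix.cons_val_one, Matrix.cons_val]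
  ring

/-- **Block-swap covariance of the device generator at equal temperatures**:
`L^{(N,M)}_dev (f ∘ Φ) = (L^{(M,N)}_dev f) ∘ Φ` (`N, M ≥ 1`, all thermostats at `T`). -/
theorem deviceGenerator_comp_blockSwap_const (P : OscillatorChain) (hV : ∀ r, P.V (-r) = P.V r)
    (hN : 1 ≤ N) (hM : 1 ≤ M) (T : ℝ) (f : PhaseSpace (M + N) → ℝ) (x : PhaseSpace (N + M)) :
    deviceGenerator P N M (fun _ => T) (f ∘ blockSwap N M) x =
      deviceGenerator P M N (fun _ => T) f (blockSwap N M x) := by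
  rw [deviceGenerator, deviceGenerator, generator_comp_blockSwap P hV,
    thermo_comp_blockSwap (s := N - 1) (s' := M) (by omega) (by omega),
    thermo_comp_blockSwap (s := N) (s' := M - 1) (by omega) (by omega)]
  ring

/-! ### The block swap and the Gibbs state -/

/-- The Gibbs density is block-swap invariant (even interaction). -/
theorem gibbsDensity_blockSwap (P : OscillatorChain) (hV : ∀ r, P.V (-r) = P.V r) (T : ℝ)
    (x : PhaseSpace (N + M)) :
    P.gibbsDensity (M + N) T (blockSwap N M x) = P.gibbsDensity (N + M) T x := by
  simp only [OscillatorChain.gibbsDensity, hamiltonian_blockSwap P hV]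

/-- The block swap as a measurable equivalence. -/
def blockSwapM (N M : ℕ) : PhaseSpace (N + M) ≃ᵐ PhaseSpace (M + N) := relabelM (swapIdx N M)

/-- The measurable equivalence is the block swap. -/
@[simp] theorem blockSwapM_apply (x : PhaseSpace (N + M)) : blockSwapM N M x = blockSwap N M x :=
  relabelM_apply _ x

/-- The block swap preserves Lebesgue measure. -/
theorem measurePreserving_blockSwapM :
    MeasurePreserving (blockSwapM N M) (volume : Measure (PhaseSpace (N + M))) volume :=
  measurePreserving_relabelM _

/-- `∫ F (Φ x) dx = ∫ F`. -/
theorem integral_comp_blockSwap (F : PhaseSpace (M + N) → ℝ) :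
    ∫ x, F (blockSwap N M x) = ∫ y, F y :=
  integral_comp_relabel _ F

/-- **The Gibbs state is block-swap invariant**: `∫ F ∘ Φ dμ_T^{(N+M)} = ∫ F dμ_T^{(M+N)}`
(even interaction; any `T`, any `F`). -/
theorem integral_gibbsMeasure_comp_blockSwap (P : OscillatorChain) (hV : ∀ r, P.V (-r) = P.V r)
    (T : ℝ) (F : PhaseSpace (M + N) → ℝ) :
    ∫ x, F (blockSwap N M x) ∂(P.gibbsMeasure (N + M) T) = ∫ y, F y ∂(P.gibbsMeasure (M + N) T) := by
  rw [P.integral_gibbsMeasure, P.integral_gibbsMeasure]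
  have h1 : ∫ x, F (blockSwap N M x) * P.gibbsDensity (N + M) T x =
      ∫ y, F y * P.gibbsDensity (M + N) T y := by
    have := integral_comp_blockSwap (N := N) (M := M) (fun y => F y * P.gibbsDensity (M + N) T y)
    simpa only [gibbsDensity_blockSwap P hV] using this
  have h2 : ∫ x, P.gibbsDensity (N + M) T x = ∫ y, P.gibbsDensity (M + N) T y := by
    have := integral_comp_blockSwap (N := N) (M := M) (P.gibbsDensity (M + N) T)
    simpa only [gibbsDensity_blockSwap P hV] using this
  rw [h1, h2]

/-- The block swap transports the Gibbs state of the `(N+M)`-chain to that of the `(M+N)`-chain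
(as a measure-preserving map; even interaction). -/
theorem measurePreserving_blockSwap_gibbsMeasure (P : OscillatorChain)
    (hV : ∀ r, P.V (-r) = P.V r) (T : ℝ) :
    MeasurePreserving (blockSwapM N M) (P.gibbsMeasure (N + M) T) (P.gibbsMeasure (M + N) T) := by
  refine ⟨(blockSwapM N M).measurable, Measure.ext fun s hs => ?_⟩
  rw [Measure.map_apply (blockSwapM N M).measurable hs, OscillatorChain.gibbsMeasure_eq,
    OscillatorChain.gibbsMeasure_eq, tilted_apply' _ _ hs,
    tilted_apply' _ _ ((blockSwapM N M).measurable hs)]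
  have hZ : ∫ x, Real.exp (-P.hamiltonian (N + M) x / T) =
      ∫ y, Real.exp (-P.hamiltonian (M + N) y / T) := by
    have := integral_comp_blockSwap (N := N) (M := M)
      (fun y => Real.exp (-P.hamiltonian (M + N) y / T))
    simpa only [hamiltonian_blockSwap P hV] using this
  have h := (measurePreserving_blockSwapM (N := N) (M := M)).setLIntegral_comp_preimage_emb
    (blockSwapM N M).measurableEmbedding
    (fun y => ENNReal.ofReal (Real.exp (-P.hamiltonian (M + N) y / T) /
      ∫ z, Real.exp (-P.hamiltonian (M + N) z / T))) s
  rw [← h]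
  refine setLIntegral_congr_fun ((blockSwapM N M).measurable hs) (fun x _ => ?_)
  rw [hZ, blockSwapM_apply, OscillatorChain.exp_neg_hamiltonian_div,
    OscillatorChain.exp_neg_hamiltonian_div, gibbsDensity_blockSwap P hV]

/-- Square-integrable observables of the `(M+N)`-chain pull back to square-integrable observables
of the `(N+M)`-chain. -/
theorem memLp_comp_blockSwap (P : OscillatorChain) (hV : ∀ r, P.V (-r) = P.V r) (T : ℝ)
    {g : PhaseSpace (M + N) → ℝ} (hg : MemLp g 2 (P.gibbsMeasure (M + N) T)) :
    MemLp (g ∘ blockSwap N M) 2 (P.gibbsMeasure (N + M) T) := by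
  have h := hg.comp_measurePreserving (measurePreserving_blockSwap_gibbsMeasure P hV T)
  have e : g ∘ blockSwapM N M = g ∘ blockSwap N M := funext fun x => by simp
  rwa [e] at h

/-- The FPU-β interaction of `pinnedChain` is even. -/
theorem pinnedChain_V_even (ω₂ lam β γ r : ℝ) :
    (pinnedChain ω₂ lam β γ).V (-r) = (pinnedChain ω₂ lam β γ).V r := by
  show (-r) ^ 2 / 2 + β * (-r) ^ 4 / 4 = r ^ 2 / 2 + β * r ^ 4 / 4
  ring


/-- Registered helper sub-goal `helper_terminationBlockSwap` (= `deviceGenerator_comp_blockSwap_const`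
in stub form, the block swap written out): the `(N, M)`-device on `f ∘ Φ` is the `(M, N)`-device on
`f`, at equal temperatures. -/
theorem helper_terminationBlockSwap : ∀ (P : OscillatorChain), (∀ r, P.V (-r) = P.V r) → ∀ {N M : ℕ}, 1 ≤ N → 1 ≤ M → ∀ (T : ℝ) (f : PhaseSpace (M + N) → ℝ) (x : PhaseSpace (N + M)), deviceGenerator P N M (fun _ => T) (f ∘ fun y : PhaseSpace (N + M) => ((fun i : Fin (M + N) => y.1 ⟨N + M - 1 - i.val, by omega⟩), (fun i : Fin (M + N) => y.2 ⟨N + M - 1 - i.val, by omega⟩))) x = deviceGenerator P M N (fun _ => T) f ((fun i : Fin (M + N) => x.1 ⟨N + M - 1 - i.val, by omega⟩), (fun i : Fin (M + N) => x.2 ⟨N + M - 1 - i.val, by omega⟩)) :=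
  fun P hV _ _ hN hM T f x => deviceGenerator_comp_blockSwap_const P hV hN hM T f x
end Swap

end Summit.AtomisticToContinuum.FouriersLaw.Theorems.SuperadditiveResistance.TerminationLocality

end
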